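import Literature.Computability.AlgebraicComplexity.LandsbergRessayreProofs
import Literature.Computability.AlgebraicComplexity.LR21CanonicalSubspaces
import HarnessLib

/-!
# Landsberg–Ressayre, Thm. 2.1 — exact lifts of the TWO-SIDED monomial symmetries, from matrices

Topic `Literature/Computability/AlgebraicComplexity`.  A piece of the bottom-up proof of the named
fact `lr_full_equivariant_lower` (`LandsbergRessayre.lean`; LR17 Thm. 2.1, lower bound), the
two-sided companion of the `Units`/`MatrixLift` sections of `LRPencilOfMatrix.lean`: it turns the
tree's hypothesis `IsEquivariantDetRepr (permSymmetrySubst ℂ m) f A` into the linear-algebra data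
consumed by the pencil files (`LR21CanonicalSubspaces.Lift₂`, `LRLiftCharacter`); it imports the
one-sided assembly `LandsbergRessayreProofs.lean` for `exists_matrix_lift`/`mul_eq_of_eq_mul_mul_inv`:

* the elements `g ⊗ h` (`Matrix.GeneralLinearGroup.kronecker g h`) of `GL(m²)` for monomial
  `g, h` lie in `permSymmetrySubst` (LR17 §2.1: `(N(T^{GL(E)}) × N(T^{GL(F)}))/ℂ* ⊆ 𝔾_{perm_m}`);
* coefficient extraction for the torus pair `diag(d) ⊗ diag(e)` (`x_{kj} ↦ d_k e_j x_{kj}`) and the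
  permutation pair `P_σ ⊗ P_π` (`x_{kj} ↦ x_{σk, πj}`);
* `exists_torusPair_matrices`, `exists_permPair_matrices`: an equivariant representation has
  matrices `g, h ∈ GL_n` with `Ã(γ·x) = g Ã(x) h⁻¹`, `g Λ = Λ h` and
  `g A_{kj} = d_k e_j · A_{kj} h`, resp. `g A_{kj} = A_{σ k, π j} h` (LR17 Def. 1.3 unpacked);
* `lift₂OfMatrices`: such matrices give an exact `Lift₂` of the pencil `(toLin' Λ, toLin' A_{kj})`
  (the structure of `LR21CanonicalSubspaces.lean`), whence `nonempty_lift₂_torusPair`,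
  `nonempty_lift₂_permPair`.

Everything is proved; no named facts.  The transposition `x ↦ xᵀ` (the `ℤ₂` of `𝔾_{perm_m}`) is not
needed for the lower bound and is not treated here.

## References

* J. M. Landsberg, N. Ressayre, *Permanent v. determinant: an exponential lower bound assuming
  symmetry and a potential path towards Valiant's conjecture*, Differential Geom. Appl. 55 (2017)
  146–166, arXiv:1508.05788: Def. 1.3, §2.1 (`𝔾_{perm_m}`).
-/

noncomputable section

namespace Literature.Computability.AlgebraicComplexity

namespace LRPencil

open _root_.Matrix MvPolynomial Finset
open scoped Kronecker

/-! ### `g ⊗ h ∈ permSymmetrySubst` for monomial `g, h` -/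

section Units

variable (k : Type*) [Field k] {m : ℕ}

/-- The matrix of `g ⊗ h ∈ GL(m²)`. [folklore] -/
theorem coe_kronecker (g h : GL (Fin m) k) :
    ((Matrix.GeneralLinearGroup.kronecker g h : GL (Fin m × Fin m) k) :
        Matrix (Fin m × Fin m) (Fin m × Fin m) k) =
      (g : Matrix (Fin m) (Fin m) k) ⊗ₖ (h : Matrix (Fin m) (Fin m) k) :=
  rfl

/-- `1 ⊗ h` is a right monomial symmetry when `h` is monomial (LR17 §2.1, `N(T^{GL(F)})`).
[cite: LandsbergRessayre2017, §2.1] -/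
theorem one_kronecker_mem {h : GL (Fin m) k} (hh : h ∈ monomialSubgroup k m) :
    Matrix.GeneralLinearGroup.kronecker (1 : GL (Fin m) k) h ∈ rightMonomialSubst k m :=
  Subgroup.subset_closure ⟨h, hh, rfl⟩

/-- The right symmetries lie in the full symmetry group. [folklore] -/
theorem rightMonomialSubst_le_permSymmetrySubst : rightMonomialSubst k m ≤ permSymmetrySubst k m :=
  fun _ hγ => Subgroup.subset_closure (Or.inl (Or.inr hγ))

/-- `g ⊗ h = (g ⊗ 1)(1 ⊗ h)`. [folklore] -/
theorem kronecker_eq_mul (g h : GL (Fin m) k) :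
    Matrix.GeneralLinearGroup.kronecker g h =
      Matrix.GeneralLinearGroup.kronecker g (1 : GL (Fin m) k) *
        Matrix.GeneralLinearGroup.kronecker (1 : GL (Fin m) k) h := by
  apply Units.ext
  change (g : Matrix (Fin m) (Fin m) k) ⊗ₖ (h : Matrix (Fin m) (Fin m) k) =
    (g : Matrix (Fin m) (Fin m) k) ⊗ₖ (1 : Matrix (Fin m) (Fin m) k) *
      (1 : Matrix (Fin m) (Fin m) k) ⊗ₖ (h : Matrix (Fin m) (Fin m) k)
  rw [← Matrix.mul_kronecker_mul, Matrix.mul_one, Matrix.one_mul]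

/-- **`g ⊗ h ∈ 𝔾_{perm_m}`** for monomial `g, h`: the substitution `x ↦ g x hᵀ`-type symmetry
generated by the left and the right monomial symmetries (LR17 §2.1:
`(N(T^{GL(E)}) × N(T^{GL(F)}))/ℂ* ⊆ 𝔾_{perm_m}`). [cite: LandsbergRessayre2017, §2.1] -/
theorem kronecker_mem_permSymmetrySubst {g h : GL (Fin m) k} (hg : g ∈ monomialSubgroup k m)
    (hh : h ∈ monomialSubgroup k m) :
    Matrix.GeneralLinearGroup.kronecker g h ∈ permSymmetrySubst k m := by
  rw [kronecker_eq_mul]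
  exact Subgroup.mul_mem _ (leftMonomialSubst_le_permSymmetrySubst k m (kronecker_one_mem k hg))
    (rightMonomialSubst_le_permSymmetrySubst k (one_kronecker_mem k hh))

/-- The substitution of `diag(d) ⊗ diag(e)` on coefficient matrices: the coefficient of `x_{kj}` is
scaled by `d_k e_j`. [cite: LandsbergRessayre2017, §2.1] -/
theorem sum_kron_diagonal_diagonal_smul {M : Type*} [AddCommMonoid M] [Module k M] (d e : Fin m → k)
    (B : Fin m × Fin m → M) (v : Fin m × Fin m) :
    ∑ i, ((Matrix.diagonal d) ⊗ₖ (Matrix.diagonal e)) v i • B i = (d v.1 * e v.2) • B v := by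
  rw [Matrix.diagonal_kronecker_diagonal, Finset.sum_eq_single v]
  · rw [Matrix.diagonal_apply_eq]
  · intro i _ hi
    rw [Matrix.diagonal_apply_ne _ (Ne.symm hi), zero_smul]
  · intro hv; exact absurd (Finset.mem_univ v) hv

/-- The substitution of `P_σ ⊗ P_π` on coefficient matrices: the coefficient of `x_{kj}` goes to
`x_{σ k, π j}`. [cite: LandsbergRessayre2017, §2.1] -/
theorem sum_kron_permMatrix_permMatrix_smul {M : Type*} [AddCommMonoid M] [Module k M]
    (σ π : Equiv.Perm (Fin m)) (B : Fin m × Fin m → M) (v : Fin m × Fin m) :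
    ∑ i, ((σ.permMatrix k) ⊗ₖ (π.permMatrix k)) v i • B i = B (σ v.1, π v.2) := by
  rw [Fintype.sum_prod_type, Finset.sum_eq_single (σ v.1)]
  · rw [Finset.sum_eq_single (π v.2)]
    · simp [Equiv.Perm.permMatrix, PEquiv.toMatrix_apply]
    · intro j _ hj
      simp [Equiv.Perm.permMatrix, PEquiv.toMatrix_apply, Ne.symm hj]
    · simp
  · intro i _ hi
    refine Finset.sum_eq_zero fun j _ => ?_
    simp [Equiv.Perm.permMatrix, PEquiv.toMatrix_apply, Ne.symm hi]
  · simp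

end Units

/-! ### From an equivariant representation to matrices -/

section Matrices

variable {m n : ℕ} {f : MvPolynomial (Fin m × Fin m) ℂ}
  {A : Matrix (Fin n) (Fin n) (MvPolynomial (Fin m × Fin m) ℂ)}

/-- From an exact lift of `g ⊗ h` (`g, h` monomial): matrices `P, Q ∈ GL_n` with
`Ã((g ⊗ h)·x) = P Ã(x) Q⁻¹`, `P Λ = Λ Q` and `Σ_i (g ⊗ h)_{w i} A_i = P A_w Q⁻¹` for every variable `w`
(LR17 Def. 1.3 on the constant and linear parts). [cite: LandsbergRessayre2017, Def. 1.3] -/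
theorem exists_matrix_lift₂ (hA : IsEquivariantDetRepr (permSymmetrySubst ℂ m) f A)
    {g h : GL (Fin m) ℂ} (hg : g ∈ monomialSubgroup ℂ m) (hh : h ∈ monomialSubgroup ℂ m) :
    ∃ P Q : GL (Fin n) ℂ,
      Matrix.linSubstEntries (Matrix.GeneralLinearGroup.kronecker g h) A =
        (P : Matrix (Fin n) (Fin n) ℂ).map C * A * ((Q⁻¹ : GL (Fin n) ℂ) : Matrix (Fin n) (Fin n) ℂ).map C ∧
      (P : Matrix (Fin n) (Fin n) ℂ) * constPart A = constPart A * (Q : Matrix (Fin n) (Fin n) ℂ) ∧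
      ∀ w, (∑ i, ((g : Matrix (Fin m) (Fin m) ℂ) ⊗ₖ (h : Matrix (Fin m) (Fin m) ℂ)) w i • coeffMat A i) =
        (P : Matrix (Fin n) (Fin n) ℂ) * coeffMat A w * ((Q⁻¹ : GL (Fin n) ℂ) : Matrix (Fin n) (Fin n) ℂ) := by
  obtain ⟨P, Q, hPQ, hΛ⟩ := hA.exists_lift_stabilising (kronecker_mem_permSymmetrySubst ℂ hg hh)
  refine ⟨P, Q, hPQ, hΛ, fun w => ?_⟩
  have e : coeffMat (Matrix.linSubstEntries (Matrix.GeneralLinearGroup.kronecker g h) A) w =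
      coeffMat ((P : Matrix (Fin n) (Fin n) ℂ).map C * A *
        ((Q⁻¹ : GL (Fin n) ℂ) : Matrix (Fin n) (Fin n) ℂ).map C) w := by rw [hPQ]
  rwa [coeffMat_linSubstEntries _ _ hA.1.1, coe_kronecker, coeffMat_C_mul_mul_C] at e

/-- **Torus pair, in matrices**: for an equivariant representation and non-zero `d, e`, there are
`P, Q ∈ GL_n` with `Ã((diag d ⊗ diag e)·x) = P Ã(x) Q⁻¹`, `P Λ = Λ Q` and
`P A_{kj} = d_k e_j · A_{kj} Q` (LR17 Def. 1.3 for `T(E) × T(F)`). [cite: LandsbergRessayre2017, Def. 1.3] -/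
theorem exists_torusPair_matrices (hA : IsEquivariantDetRepr (permSymmetrySubst ℂ m) f A)
    (d e : Fin m → ℂ) (hd : ∀ i, d i ≠ 0) (he : ∀ i, e i ≠ 0) :
    ∃ P Q : GL (Fin n) ℂ,
      Matrix.linSubstEntries
          (Matrix.GeneralLinearGroup.kronecker (diagUnit ℂ d hd) (diagUnit ℂ e he)) A =
        (P : Matrix (Fin n) (Fin n) ℂ).map C * A * ((Q⁻¹ : GL (Fin n) ℂ) : Matrix (Fin n) (Fin n) ℂ).map C ∧
      (P : Matrix (Fin n) (Fin n) ℂ) * constPart A = constPart A * (Q : Matrix (Fin n) (Fin n) ℂ) ∧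
      ∀ k j, (P : Matrix (Fin n) (Fin n) ℂ) * coeffMat A (k, j) =
        (d k * e j) • (coeffMat A (k, j) * (Q : Matrix (Fin n) (Fin n) ℂ)) := by
  obtain ⟨P, Q, hPQ, hΛ, hw⟩ := exists_matrix_lift₂ hA (diagUnit_mem ℂ d hd) (diagUnit_mem ℂ e he)
  refine ⟨P, Q, hPQ, hΛ, fun k j => ?_⟩
  have e1 := hw (k, j)
  rw [coe_diagUnit, coe_diagUnit, sum_kron_diagonal_diagonal_smul] at e1
  rw [mul_eq_of_eq_mul_mul_inv e1, Matrix.smul_mul]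

/-- The matrix of the torus pair `diag(d) ⊗ diag(e)` is `diag(d) ⊗ diag(e)`. [folklore] -/
theorem coe_kronecker_diagUnit (d e : Fin m → ℂ) (hd : ∀ i, d i ≠ 0) (he : ∀ i, e i ≠ 0) :
    ((Matrix.GeneralLinearGroup.kronecker (diagUnit ℂ d hd) (diagUnit ℂ e he) :
        GL (Fin m × Fin m) ℂ) : Matrix (Fin m × Fin m) (Fin m × Fin m) ℂ) =
      Matrix.diagonal d ⊗ₖ Matrix.diagonal e :=
  rfl

/-- **Permutation pair, in matrices**: for an equivariant representation and `σ, π ∈ 𝔖_m`, there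
are `P, Q ∈ GL_n` with `Ã((P_σ ⊗ P_π)·x) = P Ã(x) Q⁻¹`, `P Λ = Λ Q` and `P A_{kj} = A_{σ k, π j} Q`
(LR17 Def. 1.3 for `𝔖_m × 𝔖_m`). [cite: LandsbergRessayre2017, Def. 1.3] -/
theorem exists_permPair_matrices (hA : IsEquivariantDetRepr (permSymmetrySubst ℂ m) f A)
    (σ π : Equiv.Perm (Fin m)) :
    ∃ P Q : GL (Fin n) ℂ,
      Matrix.linSubstEntries
          (Matrix.GeneralLinearGroup.kronecker (permUnit ℂ σ) (permUnit ℂ π)) A =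
        (P : Matrix (Fin n) (Fin n) ℂ).map C * A * ((Q⁻¹ : GL (Fin n) ℂ) : Matrix (Fin n) (Fin n) ℂ).map C ∧
      (P : Matrix (Fin n) (Fin n) ℂ) * constPart A = constPart A * (Q : Matrix (Fin n) (Fin n) ℂ) ∧
      ∀ k j, (P : Matrix (Fin n) (Fin n) ℂ) * coeffMat A (k, j) =
        coeffMat A (σ k, π j) * (Q : Matrix (Fin n) (Fin n) ℂ) := by
  obtain ⟨P, Q, hPQ, hΛ, hw⟩ := exists_matrix_lift₂ hA (permUnit_mem ℂ σ) (permUnit_mem ℂ π)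
  refine ⟨P, Q, hPQ, hΛ, fun k j => ?_⟩
  have e1 := hw (k, j)
  rw [coe_permUnit, coe_permUnit, sum_kron_permMatrix_permMatrix_smul] at e1
  exact mul_eq_of_eq_mul_mul_inv e1

end Matrices

/-! ### From matrices to an exact `Lift₂` of the pencil -/

section MatrixLift

variable {m n : ℕ}

/-- Matrices `P, Q ∈ GL_n` with `P Λ = Λ Q` and `P A_{kj} = (c_{inl k} c_{inr j}) · A_{σ k, τ j} Q`
give an exact `Lift₂` of the pencil `(toLin' Λ, toLin' A_{kj})` (LR17 Def. 1.3 in coordinates, for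
the two-sided group). [cite: LandsbergRessayre2017, Def. 1.3] -/
def lift₂OfMatrices (Λm : Matrix (Fin n) (Fin n) ℂ) (Am : Fin m → Fin m → Matrix (Fin n) (Fin n) ℂ)
    (σ τ : Equiv.Perm (Fin m)) (c : Fin m ⊕ Fin m → ℂ) (hc : ∀ x, c x ≠ 0) (P Q : GL (Fin n) ℂ)
    (hΛ : (P : Matrix (Fin n) (Fin n) ℂ) * Λm = Λm * (Q : Matrix (Fin n) (Fin n) ℂ))
    (hA : ∀ k j, (P : Matrix (Fin n) (Fin n) ℂ) * Am k j =
      (c (Sum.inl k) * c (Sum.inr j)) • (Am (σ k) (τ j) * (Q : Matrix (Fin n) (Fin n) ℂ))) :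
    Lift₂ (Matrix.toLin' Λm) (fun k j => Matrix.toLin' (Am k j)) σ τ c where
  B := Matrix.toLinearEquiv' (P : Matrix (Fin n) (Fin n) ℂ) (Units.invertible P)
  C := Matrix.toLinearEquiv' (Q : Matrix (Fin n) (Fin n) ℂ) (Units.invertible Q)
  c_ne := hc
  comm_Λ v := by
    show Matrix.toLin' (P : Matrix (Fin n) (Fin n) ℂ) (Matrix.toLin' Λm v) =
      Matrix.toLin' Λm (Matrix.toLin' (Q : Matrix (Fin n) (Fin n) ℂ) v)
    rw [← Matrix.toLin'_mul_apply, hΛ, Matrix.toLin'_mul_apply]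
  comm_A k j v := by
    show Matrix.toLin' (P : Matrix (Fin n) (Fin n) ℂ) (Matrix.toLin' (Am k j) v) =
      (c (Sum.inl k) * c (Sum.inr j)) •
        Matrix.toLin' (Am (σ k) (τ j)) (Matrix.toLin' (Q : Matrix (Fin n) (Fin n) ℂ) v)
    rw [← Matrix.toLin'_mul_apply, hA, map_smul, LinearMap.smul_apply, Matrix.toLin'_mul_apply]

variable {f : MvPolynomial (Fin m × Fin m) ℂ} {A : Matrix (Fin n) (Fin n) (MvPolynomial (Fin m × Fin m) ℂ)}

/-- **The torus pair lifts**: an equivariant representation gives an exact `Lift₂` of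
`diag(d) ⊗ diag(e)` (`σ = τ = 1`, scalars `Sum.elim d e`). [cite: LandsbergRessayre2017, Def. 1.3] -/
theorem nonempty_lift₂_torusPair (hA : IsEquivariantDetRepr (permSymmetrySubst ℂ m) f A)
    (d e : Fin m → ℂ) (hd : ∀ i, d i ≠ 0) (he : ∀ i, e i ≠ 0) :
    Nonempty (Lift₂ (Matrix.toLin' (constPart A)) (fun k j => Matrix.toLin' (coeffMat A (k, j)))
      1 1 (Sum.elim d e)) := by
  obtain ⟨P, Q, -, hΛ, hkj⟩ := exists_torusPair_matrices hA d e hd he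
  refine ⟨lift₂OfMatrices (constPart A) (fun k j => coeffMat A (k, j)) 1 1 (Sum.elim d e) ?_ P Q hΛ ?_⟩
  · rintro (i | i)
    · exact hd i
    · exact he i
  · intro k j
    rw [hkj k j]
    rfl

/-- **The permutation pair lifts**: an equivariant representation gives an exact `Lift₂` of
`P_σ ⊗ P_π` (scalars `1`). [cite: LandsbergRessayre2017, Def. 1.3] -/
theorem nonempty_lift₂_permPair (hA : IsEquivariantDetRepr (permSymmetrySubst ℂ m) f A)
    (σ π : Equiv.Perm (Fin m)) :
    Nonempty (Lift₂ (Matrix.toLin' (constPart A)) (fun k j => Matrix.toLin' (coeffMat A (k, j)))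
      σ π fun _ => (1 : ℂ)) := by
  obtain ⟨P, Q, -, hΛ, hkj⟩ := exists_permPair_matrices hA σ π
  refine ⟨lift₂OfMatrices (constPart A) (fun k j => coeffMat A (k, j)) σ π (fun _ => 1)
    (fun _ => one_ne_zero) P Q hΛ fun k j => ?_⟩
  rw [hkj k j, one_mul, one_smul]

end MatrixLift

end LRPencil

end Literature.Computability.AlgebraicComplexity
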